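import Mathlib
import Summits.Ventures.LatticeQCDFlow.Scaling.TiltedCovarianceAtomic
import Summits.Ventures.LatticeQCDFlow.Scaling.U1CubeSum

/-!
# LatticeQCDFlow / Scaling — the leading-coefficient identity (LC) at separation one for `U(1)`:
# the truncated plaquette–plaquette expectation of the torus system is `β⁴/32 + O(β⁵)`

HONEST FRAMING: exact (Metropolis-corrected) sampling algorithms for lattice gauge theory;
figures of merit are autocorrelation/cost numbers at stated couplings and volumes; no
continuum-physics claim.

Venture `LatticeQCDFlow` (cell pub-lqcd), topic `Scaling`, FANOUT row 30 (lean-1) — OUR WORK: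
**(LC) at `t = 1` for `G = U(1)`** (HOME/lean/theory2/LANDING.md §32, "THE SUCCESSOR'S TARGET";
THEORY-2.md §3.1 (hw)).  For the torus plaquette system `torusSystem u1Rep L` of side `L ≥ 3`
(`StrongCouplingTorusSystem`), every `d`, directions `i < j` and `a ∉ {i, j}` (so `d ≥ 3`), and
the plaquette observable `P = plaquetteObs u1Rep 0 i j` of the infinite lattice periodised through
`torusRed L` — once at the origin and once translated by `e_a` (`configShift (e_a)`):
* `plaquetteObs_torusRed`, `plaquetteObs_configShift_torusRed` — the two periodised observables are
  the torus plaquette cosines `c_top`, `c_bot` of `Scaling/TorusCubeGeometry.lean`;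
* `expect_torus_u1_eq_tilt` — system expectations are ratios of tilted integrals
  `∫ F e^{βC} dν / ∫ e^{βC} dν`, `C = c_top + c_bot + Crest` the total plaquette cosine (the
  constant `e^{-β #plaquettes}` cancels);
* **`truncated_expect_jetEq_u1`** — `⟨P · P∘θ⟩ − ⟨P⟩⟨P∘θ⟩ = β⁴/32 + O(β⁵)` at `β = 0`
  (`JetEq 5`), i.e. `b = 2^{-(4t+1)} N^{-4t} = 1/32`, `n = 4t = 4` at `t = 1`, `N = 1`
  [cite: MontvayMunster1994, §3.6.2 (3.437)]; [cite: Schor1984, Thm 3.2] — from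
  `Tilted.cov_jetEq_of_atomic` fed with the lattice moments of `U1AtomicMoments`,
  `U1ConnectedSums`, `U1CubeSum`.
This is the hypothesis `hLC` of theory2's item 120 `torus_truncated_floor_of_leadingCoeff` for
`good = {L | 2 < L + 1}`, stated here on `torusSystem` directly (item 120's `torusTruncC` is this
difference verbatim).  Elementary given the imports; nothing is cited as a fact; no `def`, no
`sorry`.
-/

noncomputable section

open MeasureTheory Filter Topology Finset
open Literature.MathematicalPhysics.QuantumFieldTheory
open Literature.MathematicalPhysics.QuantumLattice (u1Rep plaquetteObs configShift configShift_apply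
  plaquetteHolonomyZd)
open Literature.Probability.LatticeModels (Torus.proj Torus.proj_apply)
open Summit.Ventures.LatticeQCDFlow.Theory2.Lattice.TorusGeom
open Summit.Ventures.LatticeQCDFlow.Theory2.Tilted

namespace Summit.Ventures.LatticeQCDFlow.Theory2.Lattice.U1Torus

variable {d L : ℕ} [NeZero L] {i j a : Fin d}

/-! ## §1. The periodised plaquette observables are `c_top` and `c_bot` -/

omit [NeZero L] in
/-- `π(0) = 0`. [folklore] -/
theorem torusProj_zero : (Torus.proj L (0 : Literature.Probability.LatticeModels.Site d) : Site d L) = 0 := by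
  funext k; simp [Torus.proj_apply]

omit [NeZero L] in
/-- `π(−e_a) = −e_a`. [folklore] -/
theorem torusProj_neg_single (a : Fin d) :
    (Torus.proj L (-(Pi.single a (1 : ℤ)) : Literature.Probability.LatticeModels.Site d) : Site d L) =
      -Pi.single a 1 := by
  rw [← zero_sub, torusProj_site_sub, torusProj_zero, torusProj_site_single, zero_sub]

/-- The plaquette observable of `U(1)` is the real part of the holonomy. [folklore] -/
theorem plaquetteObs_u1Rep (x : Literature.Probability.LatticeModels.Site d) (i j : Fin d)
    (W : ZdGaugeConfig d Circle) :
    plaquetteObs u1Rep x i j W = ((plaquetteHolonomyZd W x i j : Circle) : ℂ).re := by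
  simp [plaquetteObs]

omit [NeZero L] in
/-- **The periodised plaquette at the origin is `c_top`.** [folklore] -/
theorem plaquetteObs_torusRed (i j : Fin d) (U : ZdGaugeConfig d Circle) :
    plaquetteObs u1Rep 0 i j (U ∘ torusRed L) = cosT L (top i j) U := by
  rw [plaquetteObs_u1Rep, cosT]
  congr 2
  simp only [plaquetteHolonomyZd, holT, top, plaquetteHolonomy, torusSigma_apply,
    Function.comp_apply, torusRed, Literature.MathematicalPhysics.QuantumLattice.torusEdge,
    torusProj_site_add_single, torusProj_zero]

omit [NeZero L] in
/-- **The periodised plaquette translated by `e_a` is `c_bot`** (the plaquette at `−e_a`). [folklore] -/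
theorem plaquetteObs_configShift_torusRed (i j a : Fin d) (U : ZdGaugeConfig d Circle) :
    plaquetteObs u1Rep 0 i j (configShift (Pi.single a 1) (U ∘ torusRed L)) = cosT L (bot i j a) U := by
  rw [plaquetteObs_u1Rep, cosT]
  congr 2
  have s1 : (0 : Literature.Probability.LatticeModels.Site d) - Pi.single a 1 = -Pi.single a 1 :=
    zero_sub _
  have s2 : (0 : Literature.Probability.LatticeModels.Site d) + Pi.single i 1 - Pi.single a 1 =
      -Pi.single a 1 + Pi.single i 1 := by abel
  have s3 : (0 : Literature.Probability.LatticeModels.Site d) + Pi.single j 1 - Pi.single a 1 =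
      -Pi.single a 1 + Pi.single j 1 := by abel
  simp only [plaquetteHolonomyZd, holT, bot, plaquetteHolonomy, torusSigma_apply, configShift_apply,
    Function.comp_apply, torusRed, Literature.MathematicalPhysics.QuantumLattice.torusEdge, s1, s2, s3,
    torusProj_site_add_single, torusProj_neg_single]

/-! ## §2. System expectations are ratios of tilted integrals -/

/-- The total cost of the `U(1)` torus system: `∑_p s_p = #V − (c_top + c_bot + Crest)`. [folklore] -/
theorem sum_torusCost_u1 (hL : 2 ≤ L) (hij : i < j) (a : Fin d) (U : ZdGaugeConfig d Circle) :
    ∑ p ∈ torusGenuine d L, ((torusSystem u1Rep L).cost p U : ℂ) =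
      ((torusGenuine d L).card : ℂ) -
        ((cosT L (top i j) U + cosT L (bot i j a) U + Crest L i j a U : ℝ) : ℂ) := by
  have htop : top i j ∈ torusGenuine d L := mem_torusGenuine.2 hij
  have hbot : bot i j a ∈ (torusGenuine d L).erase (top i j) :=
    Finset.mem_erase.2 ⟨(top_ne_bot hL).symm, mem_torusGenuine.2 hij⟩
  have hsum : ∑ p ∈ torusGenuine d L, cosT L p U =
      cosT L (top i j) U + cosT L (bot i j a) U + Crest L i j a U := by
    rw [← Finset.add_sum_erase _ _ htop, ← Finset.add_sum_erase _ _ hbot, Crest, rest, add_assoc]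
  have hsumC := congrArg (fun r : ℝ => (r : ℂ)) hsum
  push_cast at hsumC
  simp only [torusSystem_cost, torusCost_u1Rep_eq]
  push_cast
  rw [Finset.sum_sub_distrib, Finset.sum_const, nsmul_eq_mul, mul_one, hsumC]

/-- **`numZ = e^{-β #V} · tilt`**: the system's generating integral is the tilted integral of the
total cosine up to the constant factor. [folklore] -/
theorem numZ_torus_u1_eq (hL : 2 ≤ L) (hij : i < j) (a : Fin d) (F : ZdGaugeConfig d Circle → ℂ)
    (β : ℂ) :
    (torusSystem u1Rep L).numZ F (torusGenuine d L) β =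
      Complex.exp (-(β * (torusGenuine d L).card)) *
        tilt (zdHaar d Circle) (fun U => cosT L (top i j) U + cosT L (bot i j a) U + Crest L i j a U)
          F β := by
  rw [PlaqSystem.numZ_eq_integral_exp, tilt, ← integral_const_mul]
  refine integral_congr_ae (Eventually.of_forall fun U => ?_)
  simp only [sum_torusCost_u1 hL hij a U]
  rw [show -(β * (((torusGenuine d L).card : ℂ) -
      ((cosT L (top i j) U + cosT L (bot i j a) U + Crest L i j a U : ℝ) : ℂ))) =
      -(β * (torusGenuine d L).card) +
        β * ((cosT L (top i j) U + cosT L (bot i j a) U + Crest L i j a U : ℝ) : ℂ) by ring,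
    Complex.exp_add]
  ring

/-- **System expectations are tilted ratios**: `⟨F⟩_V(β) = ∫ F e^{βC} / ∫ e^{βC}`. [folklore] -/
theorem expect_torus_u1_eq_tilt (hL : 2 ≤ L) (hij : i < j) (a : Fin d)
    (F : ZdGaugeConfig d Circle → ℂ) (β : ℂ) :
    (torusSystem u1Rep L).expect F (torusGenuine d L) β =
      tilt (zdHaar d Circle) (fun U => cosT L (top i j) U + cosT L (bot i j a) U + Crest L i j a U) F β /
        tilt (zdHaar d Circle) (fun U => cosT L (top i j) U + cosT L (bot i j a) U + Crest L i j a U)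
          (fun _ => 1) β := by
  rw [PlaqSystem.expect, PlaqSystem.partZ, numZ_torus_u1_eq hL hij a, numZ_torus_u1_eq hL hij a,
    mul_div_mul_left _ _ (Complex.exp_ne_zero _)]

/-! ## §3. (LC) at separation one -/

/-- The circle moments `m_k = ∫ (Re z)^k dHaar`, `k ≤ 4`. [folklore] -/
theorem circleMoment_values :
    (∫ z, ((z : ℂ).re) ^ 0 ∂(haarProbability Circle)) = 1 ∧
      (∫ z, ((z : ℂ).re) ^ 1 ∂(haarProbability Circle)) = 0 ∧
      (∫ z, ((z : ℂ).re) ^ 2 ∂(haarProbability Circle)) = 1 / 2 ∧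
      (∫ z, ((z : ℂ).re) ^ 3 ∂(haarProbability Circle)) = 0 ∧
      (∫ z, ((z : ℂ).re) ^ 4 ∂(haarProbability Circle)) = 3 / 8 := by
  refine ⟨by simp, ?_, integral_re_sq, integral_re_cube, integral_re_four⟩
  simp only [pow_one]; exact integral_re

/-- **(LC) AT SEPARATION ONE FOR `U(1)`.**  For the torus plaquette system of side `L ≥ 3` in any
dimension, directions `i < j`, `a ∉ {i, j}`, and `P` the periodised `U(1)` plaquette observable at
the origin in the `(i, j)` plane, the truncated expectation of `P` and `P ∘ θ_{e_a}` (complex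
coupling `β`, all genuine plaquettes switched on) satisfies
`⟨P · P∘θ⟩ − ⟨P⟩⟨P∘θ⟩ = β⁴/32 + O(β⁵)` at `β = 0`. [folklore] -/
theorem truncated_expect_jetEq_u1 (hL : 3 ≤ L) (hij : i < j) (hai : a ≠ i) (haj : a ≠ j) :
    JetEq 5
      (fun β => (torusSystem u1Rep L).expect
          (fun U => ((plaquetteObs u1Rep 0 i j (U ∘ torusRed L) : ℝ) : ℂ) *
            ((plaquetteObs u1Rep 0 i j (configShift (Pi.single a 1) (U ∘ torusRed L)) : ℝ) : ℂ))
          (torusGenuine d L) β -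
        (torusSystem u1Rep L).expect
            (fun U => ((plaquetteObs u1Rep 0 i j (U ∘ torusRed L) : ℝ) : ℂ)) (torusGenuine d L) β *
          (torusSystem u1Rep L).expect
            (fun U => ((plaquetteObs u1Rep 0 i j (configShift (Pi.single a 1) (U ∘ torusRed L)) : ℝ) : ℂ))
            (torusGenuine d L) β)
      (fun β => β ^ 4 / 32) := by
  have hL2 : 2 ≤ L := by omega
  simp only [plaquetteObs_torusRed, plaquetteObs_configShift_torusRed, expect_torus_u1_eq_tilt hL2 hij a]
  have hXY : (fun U : ZdGaugeConfig d Circle => ((cosT L (top i j) U : ℝ) : ℂ) * ((cosT L (bot i j a) U : ℝ) : ℂ)) =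
      fun U => ((cosT L (top i j) U * cosT L (bot i j a) U : ℝ) : ℂ) := by
    funext U; push_cast; rfl
  rw [hXY]
  obtain ⟨hm0, hm1, hm2, hm3, hm4⟩ := circleMoment_values
  exact cov_jetEq_of_atomic (ν := zdHaar d Circle) (m := fun k => ∫ z, ((z : ℂ).re) ^ k ∂(haarProbability Circle))
    (lam := ((rest L i j a).card : ℝ) / 2)
    (measurable_cosT L _) (measurable_cosT L _) (continuous_Crest i j a).measurable
    (abs_cosT_le_one L _) (abs_cosT_le_one L _) (abs_Crest_le i j a) hm0 hm1 hm2 hm3 hm4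
    (integral_X_pow_mul_Y_pow hL hij hai haj) (integral_XYpow_Crest_one hL hij)
    (integral_XYpow_Crest_sq hL hij hai haj) (integral_X_Ypow_Crest_cube hL hij hai haj)
    (integral_Xpow_Y_Crest_cube hL hij hai haj) (integral_XY_Crest_four hL hij hai haj)

end Summit.Ventures.LatticeQCDFlow.Theory2.Lattice.U1Torus

end
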